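import Literature.InformationTheory.QuantumCodes.IrreducibleClusters
import Literature.InformationTheory.QuantumCodes.ErasureDecoding
import Literature.InformationTheory.QuantumCodes.PathCountingBound
import Mathlib.Analysis.SpecialFunctions.Exp
import Mathlib.Analysis.SpecialFunctions.Log.Basic
import HarnessLib

/-!
# The erasure threshold of CSS LDPC codes: `y_c ≥ 1/(w-1)` (Dumer–Kovalev–Pryadko 2015, Theorem 2
# for erasures; Kovalev–Pryadko 2013, Theorem 1)

Topic `Literature/InformationTheory/QuantumCodes` (venture QEC, LADDER-QEC rung Q5 — a certified threshold
LOWER BOUND for a NEW noise model, the quantum erasure channel; qec-lit-2). PROVED, no named fact, kernel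
axioms only; assembles `IrreducibleClusters.lean` (DKP15 Lemma 4 and the count `N_m ≤ n (w-1)^{m-1}`) with
`ErasureDecoding.lean` (correctable erasures; consistent decoders fail only on uncorrectable erasures).

**Printed statement** (DKP15 Thm. 2, erasure part `p_X = p_Z = 0`, for one error type): "Any sequence of
CSS codes [with `d ≥ D ln n`] with generator weights not exceeding `w_X`, `w_Z` can be decoded with vanishing
error probabilities if … `(w_X - 1) Υ_CSS(y, p_Z) ≤ e^{-1/D}`", `Υ_CSS(y, 0) = y`; proof (p. 4): "in the case
of erasures with single-qubit probability `y`, a bad error must cover the entire support of `U`, which gives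
simply `y^{wgt(U)}` … `N_m = 0` for `m < d`. Thus … the condition is … `Σ_{m ≥ d} N_m y^m → 0`", with
`N_m^{(X)} ≤ n (w_Z - 1)^{m-1}` (eq. (upper-bound-Nm-CSS)), so that (p. 5, the generic-`w` version of
eq. (aux-sum)) `Σ_{m ≥ d} N_m y^m ≤ (n/(w-1)) Σ_{m ≥ d} ((w-1)y)^m`, which "converges to zero as long as
`n [(w-1)y]^d → 0`. This is true for any `y < e^{-1/D}/(w-1)` … In the case of distance scaling as a power-law
or faster, the sum … vanishes anywhere within the convergence radius `y < [(w-1)]⁻¹`". Toric code: `w = 4`,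
"`y_c^* = 1/3`" (p. 5; the true value is `y_c = 1/2`, Stace–Barrett–Doherty 2009, a percolation statement
NOT proved here). Kovalev–Pryadko 2013 Thm. 1 is the same mechanism with a percolation count ("In known
locations, a code of distance `d` can correct all errors of weight `d-1` or smaller. Therefore, correcting
clusters one-by-one, we can guarantee success if all the clusters have weights `w_i < d`"; `p_e ≥ (z-1)⁻¹`).

**Typed statements.** For one error type of a CSS code on the qubit set `V` — checks `H : Matrix ι V 𝔽₂`
all of weight `≤ w` (`2 ≤ w`), trivial errors `SX ≤ 𝔽₂^V` (e.g. the row space of the other check matrix),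
and `1 ≤ d ≤ ‖x‖` for every `x ∈ ker H ∖ SX` (`d` = the distance of this error type):
* `sum_not_isCorrectableErasure_le` — for EVERY locally stochastic erasure law `μ` of parameter `p` with
  `r := (w-1) p < 1`: `Σ_{Er uncorrectable} μ Er ≤ |V| · r^d / ((w-1)(1-r))` (finite size, explicit);
* `uncorrectableProb_le` — the independent erasure channel (each qubit erased with probability `p`);
* `erasureFailureProb_le` — the same bound for the failure probability of ANY consistent erasure decoder
  (maximum likelihood / peeling / …, `ErasureDecoding.lean`);
* `cssErasureThreshold` — DKP15 Thm. 2 (erasures, power-law-or-faster distance) as a threshold: for a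
  family `i ↦ (H i, SX i, d i)` that is subexponential in its distance (`n_i r^{d_i} → 0` for all
  `0 < r < 1`), `1/(w-1)` is an `IsThresholdLowerBound` (`CodeCapacityNoise.lean`) of
  `i ↦ uncorrectableProb`; `cssErasureThreshold_log` — the printed logarithmic-distance form: `d_i ≥ D ln n_i`,
  `d_i → ∞`, `(w-1) y < e^{-1/D}` ⇒ `uncorrectableProb → 0`.
Constants are EXACTLY the printed ones (this is not the case for the tree's Pauli-noise counting bound
`LDPCCountingThreshold.lean`, whose animal constant `Δ²` the companion file `IrreducibleCountingThreshold.lean`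
now improves to the printed `w-1` by the same count).

## References

* [DumerKovalevPryadko2015] I. Dumer, A. A. Kovalev, L. P. Pryadko, PRL 115 (2015) 050502, arXiv:1412.6172
  (held `paper:arxiv-1412.6172`): Thm. 2 (chunk p0003 L96–105), p. 4 erasure case and eq.
  (succesful-decoding-depolarizing) (p0004 L60–79), eq. (upper-bound-Nm-CSS) (p0005 L26–33), eq. (aux-sum) and
  `y_c ≥ e^{-1/D}/2(w-1)` (p0005 L64–84), toric `y_c^* = 1/3` (p0006 L37–41).
* [KovalevPryadko2013] A. A. Kovalev, L. P. Pryadko, PRA 87 (2013) 020304(R), arXiv:1208.2317 (held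
  `paper:arxiv-1208.2317`): Lemma 1, Lemma 2, Thm. 1 (chunk p0003 L86–97, p0004 L13–78).
* [DelfosseZemor2020] N. Delfosse, G. Zémor, PRR 2 (2020) 033042, §2 Lemma 1 (consistent = most likely).
* [StaceBarrettDoherty2009] T. M. Stace, S. D. Barrett, A. C. Doherty, PRL 102 (2009) 200501, p. 2–3
  (`p_loss = 0.5` for the toric code, square-lattice bond percolation) — context only.
-/

namespace Literature.InformationTheory.QuantumCodes

open Finset Matrix Filter Topology

section FiniteSize

variable {ι V : Type*} [Fintype V] [DecidableEq V]

/-- **An uncorrectable erasure covers a non-trivial irreducible operator**: if some non-trivial undetectable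
error of this type is supported inside `Er`, then (DKP15 Lemma 4) so is an irreducible one, `U ⊆ Er` with
`𝟙_U ∉ SX` — "a bad error must cover the entire support of `U`". [cite: DumerKovalevPryadko2015, p. 4 (erasure case)] -/
theorem exists_irreducible_of_not_isCorrectableErasure (H : Matrix ι V (ZMod 2))
    (SX : Submodule (ZMod 2) (V → ZMod 2)) {Er : Finset V}
    (hEr : ¬ IsCorrectableErasure {x | H *ᵥ x = 0} SX Er) :
    ∃ W : Finset V, W ⊆ Er ∧ IsIrreducible H W ∧ vecOf W ∉ SX := by
  unfold IsCorrectableErasure at hEr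
  push Not at hEr
  obtain ⟨x, hx, hxE, hxS⟩ := hEr
  obtain ⟨W, hW, hirr, hWS⟩ := exists_irreducible_of_mulVec_eq_zero H SX hx hxS
  exact ⟨W, hW.trans hxE, hirr, hWS⟩

/-- **DKP15's erasure bound, finite size, any locally stochastic erasure law.** Checks of weight `≤ w`
(`w ≥ 2`), `1 ≤ d ≤` the weight of every non-trivial undetectable error of this type, erasure law `μ`
locally stochastic with parameter `p ≥ 0`, `r := (w-1)p < 1`. Then
`Σ_{Er uncorrectable} μ Er ≤ Σ_{m=d}^{|V|} N_m p^m ≤ Σ_{m ≥ d} |V| (w-1)^{m-1} p^m ≤ |V| r^d / ((w-1)(1-r))`.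
[cite: DumerKovalevPryadko2015, Thm 2 (erasure part; eqs. (succesful-decoding), (upper-bound-Nm-CSS), (aux-sum))] -/
theorem sum_not_isCorrectableErasure_le (H : Matrix ι V (ZMod 2)) (SX : Submodule (ZMod 2) (V → ZMod 2))
    {w : ℕ} (hw : 2 ≤ w) (hrow : ∀ i, (rowSupp H i).card ≤ w) {d : ℕ} (hd1 : 1 ≤ d)
    (hd : ∀ x : V → ZMod 2, H *ᵥ x = 0 → x ∉ SX → d ≤ hammingNorm x)
    {μ : Finset V → ℝ} {p : ℝ} (hμ : IsLocallyStochastic μ p) (hp0 : 0 ≤ p)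
    (hr : ((w - 1 : ℕ) : ℝ) * p < 1)
    [DecidablePred fun Er : Finset V => ¬ IsCorrectableErasure {x | H *ᵥ x = 0} (SX : Set (V → ZMod 2)) Er] :
    ∑ Er ∈ univ.filter (fun Er : Finset V => ¬ IsCorrectableErasure {x | H *ᵥ x = 0} (SX : Set (V → ZMod 2)) Er),
        μ Er ≤
      (Fintype.card V : ℝ) * (((w - 1 : ℕ) : ℝ) * p) ^ d /
        (((w - 1 : ℕ) : ℝ) * (1 - ((w - 1 : ℕ) : ℝ) * p)) := by
  classical
  set K : ℝ := ((w - 1 : ℕ) : ℝ) with hK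
  set r : ℝ := K * p with hrdef
  have hK1 : 1 ≤ K := by
    rw [hK]
    exact_mod_cast (show 1 ≤ w - 1 by omega)
  have hK0 : 0 < K := by linarith
  have hr0 : 0 ≤ r := by positivity
  have h1r : 0 < 1 - r := by linarith
  set n : ℕ := Fintype.card V with hn
  -- Step 1: the covering family of large irreducible operators
  set Bad := univ.filter (fun Er : Finset V =>
    ¬ IsCorrectableErasure {x | H *ᵥ x = 0} (SX : Set (V → ZMod 2)) Er) with hBad
  set Ps : Finset (Finset V) := univ.filter (fun W => IsIrreducible H W ∧ d ≤ W.card) with hPs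
  have hcover : ∀ Er ∈ Bad, ∃ W ∈ Ps, (fun W : Finset V => W) W ⊆ Er := by
    intro Er hEr
    rw [hBad, mem_filter] at hEr
    obtain ⟨W, hWE, hirr, hWS⟩ := exists_irreducible_of_not_isCorrectableErasure H SX hEr.2
    refine ⟨W, ?_, hWE⟩
    rw [hPs, mem_filter]
    exact ⟨mem_univ _, hirr, hirr.le_card hd hWS⟩
  have h1 := hμ.sum_le_sum_pow_of_cover Ps (fun W : Finset V => W) Bad hcover
  -- Step 2: grade the family by the size `m ∈ [d, |V|]`
  have hmaps : ∀ W ∈ Ps, W.card ∈ Finset.Ico d (n + 1) := by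
    intro W hW
    rw [hPs, mem_filter] at hW
    rw [Finset.mem_Ico]
    exact ⟨hW.2.2, Nat.lt_succ_of_le (card_le_univ W)⟩
  have h2 : ∑ W ∈ Ps, p ^ W.card =
      ∑ m ∈ Finset.Ico d (n + 1), ∑ W ∈ Ps.filter (fun W => W.card = m), p ^ W.card :=
    (Finset.sum_fiberwise_of_maps_to hmaps _).symm
  -- Step 3: each fibre has at most `N_m ≤ n (w-1)^{m-1}` members
  have hfiber : ∀ m ∈ Finset.Ico d (n + 1),
      ∑ W ∈ Ps.filter (fun W => W.card = m), p ^ W.card ≤ (n : ℝ) * K ^ (m - 1) * p ^ m := by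
    intro m _
    have hcount : ((Ps.filter (fun W => W.card = m)).card : ℝ) ≤ (n : ℝ) * K ^ (m - 1) := by
      have hsub : Ps.filter (fun W => W.card = m) ⊆
          univ.filter (fun U : Finset V => IsIrreducible H U ∧ U.card = m) := by
        intro W hW
        rw [mem_filter, hPs, mem_filter] at hW
        rw [mem_filter]
        exact ⟨mem_univ _, hW.1.2.1, hW.2⟩
      have hc := (card_le_card hsub).trans (card_irreducible_le H hrow m)
      have hc' : ((Ps.filter (fun W => W.card = m)).card : ℝ) ≤ ((n * (w - 1) ^ (m - 1) : ℕ) : ℝ) := by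
        exact_mod_cast hc
      rw [hK]
      push_cast at hc' ⊢
      exact hc'
    calc ∑ W ∈ Ps.filter (fun W => W.card = m), p ^ W.card
        = ∑ W ∈ Ps.filter (fun W => W.card = m), p ^ m :=
          Finset.sum_congr rfl fun W hW => by rw [(Finset.mem_filter.1 hW).2]
      _ = ((Ps.filter (fun W => W.card = m)).card : ℝ) * p ^ m := by
          rw [Finset.sum_const, nsmul_eq_mul]
      _ ≤ (n : ℝ) * K ^ (m - 1) * p ^ m :=
          mul_le_mul_of_nonneg_right hcount (pow_nonneg hp0 _)
  -- Step 4: the geometric tail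
  have hterm : ∀ m ∈ Finset.Ico d (n + 1), (n : ℝ) * K ^ (m - 1) * p ^ m = (n : ℝ) / K * r ^ m := by
    intro m hm
    have hm1 : 1 ≤ m := le_trans hd1 (Finset.mem_Ico.1 hm).1
    obtain ⟨m', rfl⟩ : ∃ m', m = m' + 1 := ⟨m - 1, by omega⟩
    simp only [Nat.add_sub_cancel, hrdef]
    field_simp
    ring
  have h3 : ∑ m ∈ Finset.Ico d (n + 1), (n : ℝ) * K ^ (m - 1) * p ^ m =
      (n : ℝ) / K * ∑ m ∈ Finset.Ico d (n + 1), r ^ m := by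
    rw [Finset.mul_sum]
    exact Finset.sum_congr rfl hterm
  have hgeom := geom_tail_le hr0 hr d (n + 1)
  calc ∑ Er ∈ Bad, μ Er
      ≤ ∑ W ∈ Ps, p ^ W.card := h1
    _ = ∑ m ∈ Finset.Ico d (n + 1), ∑ W ∈ Ps.filter (fun W => W.card = m), p ^ W.card := h2
    _ ≤ ∑ m ∈ Finset.Ico d (n + 1), (n : ℝ) * K ^ (m - 1) * p ^ m := Finset.sum_le_sum hfiber
    _ = (n : ℝ) / K * ∑ m ∈ Finset.Ico d (n + 1), r ^ m := h3
    _ ≤ (n : ℝ) / K * (r ^ d / (1 - r)) := mul_le_mul_of_nonneg_left hgeom (by positivity)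
    _ = (n : ℝ) * r ^ d / (K * (1 - r)) := by
        field_simp

/-- **The independent erasure channel**: with each qubit erased independently with probability
`0 ≤ p ≤ 1`, `r := (w-1)p < 1`, the probability that the erasure pattern is uncorrectable (for this error
type) is at most `|V| r^d / ((w-1)(1-r))`. [cite: DumerKovalevPryadko2015, Thm 2 (erasure part)] -/
theorem uncorrectableProb_le (H : Matrix ι V (ZMod 2)) (SX : Submodule (ZMod 2) (V → ZMod 2))
    {w : ℕ} (hw : 2 ≤ w) (hrow : ∀ i, (rowSupp H i).card ≤ w) {d : ℕ} (hd1 : 1 ≤ d)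
    (hd : ∀ x : V → ZMod 2, H *ᵥ x = 0 → x ∉ SX → d ≤ hammingNorm x)
    {p : ℝ} (hp0 : 0 ≤ p) (hp1 : p ≤ 1) (hr : ((w - 1 : ℕ) : ℝ) * p < 1) :
    ErasureDecoder.uncorrectableProb {x | H *ᵥ x = 0} (SX : Set (V → ZMod 2)) p ≤
      (Fintype.card V : ℝ) * (((w - 1 : ℕ) : ℝ) * p) ^ d /
        (((w - 1 : ℕ) : ℝ) * (1 - ((w - 1 : ℕ) : ℝ) * p)) := by
  classical
  rw [ErasureDecoder.uncorrectableProb_eq_sum]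
  exact sum_not_isCorrectableErasure_le H SX hw hrow hd1 hd (isLocallyStochastic_bernoulliWeight hp0 hp1) hp0 hr

/-- **Decoder form**: for EVERY consistent erasure decoder of this error type (any decoder answering with a
syndrome-matching correction inside the erasure — maximum-likelihood and peeling decoders in particular,
Delfosse–Zémor Lemma 1 / Thm. 1), the probability that the random erasure admits an error on which it fails
obeys the same bound. [cite: DumerKovalevPryadko2015, Thm 2 (erasure part; "can be decoded with vanishing error probabilities")] -/
theorem erasureFailureProb_le (H : Matrix ι V (ZMod 2)) (SX : Submodule (ZMod 2) (V → ZMod 2))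
    {w : ℕ} (hw : 2 ≤ w) (hrow : ∀ i, (rowSupp H i).card ≤ w) {d : ℕ} (hd1 : 1 ≤ d)
    (hd : ∀ x : V → ZMod 2, H *ᵥ x = 0 → x ∉ SX → d ≤ hammingNorm x)
    {Syn : Type*} {syn : (V → ZMod 2) → Syn} {D : ErasureDecoder V Syn}
    (hD : D.IsConsistent syn {x | H *ᵥ x = 0})
    {p : ℝ} (hp0 : 0 ≤ p) (hp1 : p ≤ 1) (hr : ((w - 1 : ℕ) : ℝ) * p < 1) :
    D.failureProb syn (SX : Set (V → ZMod 2)) p ≤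
      (Fintype.card V : ℝ) * (((w - 1 : ℕ) : ℝ) * p) ^ d /
        (((w - 1 : ℕ) : ℝ) * (1 - ((w - 1 : ℕ) : ℝ) * p)) :=
  (ErasureDecoder.failureProb_le_uncorrectableProb hD _ hp0 hp1).trans
    (uncorrectableProb_le H SX hw hrow hd1 hd hp0 hp1 hr)

end FiniteSize

/-! ### The threshold statements for code families -/

section Family

variable {n m : ℕ → ℕ}

/-- The erasure-uncorrectability family of ONE ERROR TYPE of a family of CSS codes (qubits `Fin (n i)`,
checks `H i`, trivial errors `SX i`) under independent erasures of rate `p`: `(i, p) ↦ P_p[the erasure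
pattern of code i is uncorrectable]` — the quantity whose vanishing is "decoded with vanishing error
probabilities" for every consistent erasure decoder (`ErasureDecoding.lean`).
[cite: DumerKovalevPryadko2015, Thm 2 (vanishing error probabilities)] -/
noncomputable def cssErasureFamily (H : ∀ i, Matrix (Fin (m i)) (Fin (n i)) (ZMod 2))
    (SX : ∀ i, Submodule (ZMod 2) (Fin (n i) → ZMod 2)) (i : ℕ) (p : ℝ) : ℝ :=
  ErasureDecoder.uncorrectableProb {x | H i *ᵥ x = 0} (SX i : Set (Fin (n i) → ZMod 2)) p

/-- **DKP15 Theorem 2, erasure channel, power-law-or-faster distance, as a certified threshold**: for a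
family of CSS codes (one error type) with check weights `≤ w` (`w ≥ 2`), `1 ≤ d_i ≤` distance, and SIZE
SUBEXPONENTIAL IN THE DISTANCE (`n_i r^{d_i} → 0` for every `0 < r < 1`; e.g. `d ≥ A n^α`), every erasure
rate `0 ≤ y < 1/(w-1)` is below threshold: `P_y[erasure uncorrectable] → 0` ("the sum … asymptotically
vanishes anywhere within the convergence radius"). Toric code (`w = 4`): `y_c ≥ 1/3`.
[cite: DumerKovalevPryadko2015, Thm 2 (erasures; p. 5 "y < [2(w-1)]⁻¹", toric y_c* = 1/3)] -/
theorem cssErasureThreshold (H : ∀ i, Matrix (Fin (m i)) (Fin (n i)) (ZMod 2))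
    (SX : ∀ i, Submodule (ZMod 2) (Fin (n i) → ZMod 2)) {w : ℕ} (hw : 2 ≤ w)
    (hrow : ∀ i j, (rowSupp (H i) j).card ≤ w) (d : ℕ → ℕ) (hd1 : ∀ i, 1 ≤ d i)
    (hd : ∀ i (x : Fin (n i) → ZMod 2), H i *ᵥ x = 0 → x ∉ SX i → d i ≤ hammingNorm x)
    (hgrowth : ∀ r : ℝ, 0 < r → r < 1 → Tendsto (fun i => (n i : ℝ) * r ^ d i) atTop (𝓝 0)) :
    IsThresholdLowerBound (cssErasureFamily H SX) (1 / ((w - 1 : ℕ) : ℝ)) := by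
  classical
  intro p hp0 hpp
  set K : ℝ := ((w - 1 : ℕ) : ℝ) with hK
  have hK1 : 1 ≤ K := by
    rw [hK]
    exact_mod_cast (show 1 ≤ w - 1 by omega)
  have hK0 : 0 < K := by linarith
  have hr1 : K * p < 1 := by
    have h := (lt_div_iff₀ hK0).1 hpp
    linarith
  have hp1 : p ≤ 1 := by
    have : p < 1 / K := hpp
    have h1K : 1 / K ≤ 1 := by
      rw [div_le_one hK0]
      exact hK1
    linarith
  set r : ℝ := K * p with hr
  have hr0 : 0 ≤ r := by positivity
  have hbound : ∀ i, cssErasureFamily H SX i p ≤ (n i : ℝ) * r ^ d i / (K * (1 - r)) := by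
    intro i
    have h := uncorrectableProb_le (H i) (SX i) hw (hrow i) (hd1 i) (hd i) hp0 hp1 hr1
    rw [Fintype.card_fin] at h
    exact h
  have hQ : Tendsto (fun i => (n i : ℝ) * r ^ d i / (K * (1 - r))) atTop (𝓝 0) := by
    rcases hr0.eq_or_lt with hr00 | hrpos
    · have : (fun i => (n i : ℝ) * r ^ d i / (K * (1 - r))) = fun _ => 0 := by
        funext i
        rw [← hr00, zero_pow (by have := hd1 i; omega)]
        simp
      rw [this]
      exact tendsto_const_nhds
    · have h := (hgrowth r hrpos hr1).div_const (K * (1 - r))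
      simpa using h
  have hQ' : BelowThreshold (fun i (_ : ℝ) => (n i : ℝ) * r ^ d i / (K * (1 - r))) p := hQ
  exact BelowThreshold.of_le (P := cssErasureFamily H SX) hQ'
    (fun i => ErasureDecoder.uncorrectableProb_nonneg _ _ hp0 hp1) hbound

/-- **DKP15 Theorem 2, erasure channel, logarithmic distance (as printed)**: check weights `≤ w` (`w ≥ 2`),
`d_i ≥ D ln n_i` with `D > 0`, `d_i → ∞`, and an erasure rate with `(w-1) y < e^{-1/D}` (the printed
condition "`(w_X - 1) Υ_CSS(y, 0) ≤ e^{-1/D}`", strict so that no rate is needed): then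
`P_y[erasure uncorrectable] → 0`, since `n_i ((w-1)y)^{d_i} ≤ (e^{1/D} (w-1) y)^{d_i} → 0`.
[cite: DumerKovalevPryadko2015, Thm 2 (erasures, d ≥ D ln n)] -/
theorem cssErasureThreshold_log (H : ∀ i, Matrix (Fin (m i)) (Fin (n i)) (ZMod 2))
    (SX : ∀ i, Submodule (ZMod 2) (Fin (n i) → ZMod 2)) {w : ℕ} (hw : 2 ≤ w)
    (hrow : ∀ i j, (rowSupp (H i) j).card ≤ w) (d : ℕ → ℕ) (hd1 : ∀ i, 1 ≤ d i)
    (hd : ∀ i (x : Fin (n i) → ZMod 2), H i *ᵥ x = 0 → x ∉ SX i → d i ≤ hammingNorm x)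
    {D : ℝ} (hD : 0 < D) (hlog : ∀ i, D * Real.log (n i) ≤ d i)
    (hdinf : Tendsto d atTop atTop) {p : ℝ} (hp0 : 0 ≤ p)
    (hpe : ((w - 1 : ℕ) : ℝ) * p < Real.exp (-1 / D)) :
    Tendsto (fun i => cssErasureFamily H SX i p) atTop (𝓝 0) := by
  classical
  set K : ℝ := ((w - 1 : ℕ) : ℝ) with hK
  have hK1 : 1 ≤ K := by
    rw [hK]
    exact_mod_cast (show 1 ≤ w - 1 by omega)
  have hK0 : 0 < K := by linarith
  set r : ℝ := K * p with hr
  have hr0 : 0 ≤ r := by positivity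
  have he1 : Real.exp (-1 / D) < 1 := by
    rw [Real.exp_lt_one_iff]
    have : 0 < 1 / D := by positivity
    have h' : -1 / D = -(1 / D) := by ring
    linarith
  have hr1 : r < 1 := lt_trans hpe he1
  have hp1 : p ≤ 1 := by
    by_contra h
    push Not at h
    have : K * 1 < K * p := by nlinarith
    linarith
  -- the per-code bound
  have hbound : ∀ i, cssErasureFamily H SX i p ≤ (n i : ℝ) * r ^ d i / (K * (1 - r)) := by
    intro i
    have h := uncorrectableProb_le (H i) (SX i) hw (hrow i) (hd1 i) (hd i) hp0 hp1 hr1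
    rw [Fintype.card_fin] at h
    exact h
  -- `n_i r^{d_i} ≤ (e^{1/D} r)^{d_i}` and `e^{1/D} r < 1`
  set s : ℝ := Real.exp (1 / D) * r with hs
  have hs0 : 0 ≤ s := by positivity
  have hs1 : s < 1 := by
    have h1 : Real.exp (1 / D) * Real.exp (-1 / D) = 1 := by
      rw [← Real.exp_add]
      have : 1 / D + -1 / D = 0 := by ring
      rw [this, Real.exp_zero]
    calc s = Real.exp (1 / D) * r := rfl
      _ < Real.exp (1 / D) * Real.exp (-1 / D) := mul_lt_mul_of_pos_left hpe (Real.exp_pos _)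
      _ = 1 := h1
  have hnle : ∀ i, (n i : ℝ) * r ^ d i ≤ s ^ d i := by
    intro i
    have hsd : s ^ d i = Real.exp (1 / D) ^ d i * r ^ d i := by rw [hs, mul_pow]
    rw [hsd]
    refine mul_le_mul_of_nonneg_right ?_ (pow_nonneg hr0 _)
    rw [← Real.exp_nat_mul]
    rcases Nat.eq_zero_or_pos (n i) with h0 | hpos
    · rw [h0]
      simp only [Nat.cast_zero]
      positivity
    · have hlog' : Real.log (n i) ≤ (d i : ℕ) * (1 / D) := by
        have := hlog i
        rw [mul_one_div, le_div_iff₀ hD]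
        linarith
      calc (n i : ℝ) = Real.exp (Real.log (n i)) := by
            rw [Real.exp_log (by exact_mod_cast hpos)]
        _ ≤ Real.exp ((d i : ℕ) * (1 / D)) := Real.exp_le_exp.2 hlog'
  have hslim : Tendsto (fun i => s ^ d i) atTop (𝓝 0) :=
    (tendsto_pow_atTop_nhds_zero_of_lt_one hs0 hs1).comp hdinf
  have hQ : Tendsto (fun i => s ^ d i / (K * (1 - r))) atTop (𝓝 0) := by
    have h := hslim.div_const (K * (1 - r))
    simpa using h
  have h1r : 0 < 1 - r := by linarith
  refine squeeze_zero (fun i => ErasureDecoder.uncorrectableProb_nonneg _ _ hp0 hp1) (fun i => ?_) hQ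
  calc cssErasureFamily H SX i p ≤ (n i : ℝ) * r ^ d i / (K * (1 - r)) := hbound i
    _ ≤ s ^ d i / (K * (1 - r)) := div_le_div_of_nonneg_right (hnle i) (by positivity)

end Family

end Literature.InformationTheory.QuantumCodes
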